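import Summits.CriticalPhenomena.PercolationContinuityZ3.Theorems.Transplant.FKConnectivityAllQAntipodalRootFormBase
import Summits.CriticalPhenomena.PercolationContinuityZ3.Theorems.Transplant.FKConnectivityAllQAntipodalRootFormTransfer

/-!
# Connectivity correlation inequalities for `φ_{w,q}`, every `q > 0` — ROOT-FORM CALCULUS, file 61u: GENERAL PARALLEL ATTACHMENT of a
# special-free box (`A ∥ 𝓔`): the nested root functional stays nonnegative

Support file (`--supports stmt-CriticalPhenomena-4575`), FK sub-lane `prim-bschramm-fk-2` (gen 29); builds on p205010 (kernel theorem,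
internal audit signed; external expert review pending).  Definitions `attP` (data of `A ∥ 𝓔` for an abstract special-free box `A`, i.e. a table
`α ↦ SDat` of level and pole bits) and the kind/level weights; no named facts, no sorries; standard axioms.  Memo FROM-fk-2-g28-ROOT-FORM.md §3
in FUNCTIONAL form (no layer cake is needed: the 4-slot hypothesis (H2) is fact 2 `M̃_{g∥𝓔} ≥ 0` on monotone nested weights of `Bool × C`).

Sectioning by the configuration `α` of `A`: kind `(c_A, c̄_A) = (0,0)` is an instance of `M̃_𝓔` at the shifted level, kind `(1,1)` is the
contracted AND of `𝓔` plus a pointwise nonnegative term (`EDat.slot*_par_par_mixed`), kinds `(1,0)` / `(0,1)` are the sub-slots of the parallel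
transform `parE 𝓔`; summing the latter over all `α` of a fixed level `K` gives ONE instance of fact 2 whose Bool-monotonicity is exactly
Theorem U for `A` at the exact level `K` (`#kind-10 ≥ #kind-01` against every monotone nonnegative weight).  Result: `attP_Mt_nonneg` — fact 1
for `A ∥ 𝓔` from facts 1, 2, 4 of `𝓔` and root-U of `A`.
[folklore]
-/

noncomputable section

namespace Summit.CriticalPhenomena.PercolationContinuityZ3.Theorems

namespace FK

namespace RootForm

open Finset Base

/-- parallel gluing of a special-free box datum (level, pole bits) with a pattern datum: levels add, plus one for each replica in which
both join the poles; poles joined if joined in either. (memo FROM-fk-2-g28-ROOT-FORM §3) -/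
def acomb (a : SDat) (d : PDat) : PDat := ⟨a.L + d.lam + bit (a.c && d.k1) + bit (a.cb && d.k2), a.c || d.k1, a.cb || d.k2⟩

/-- **The environment `A ∥ 𝓔`** of an abstract special-free box `A` (configuration `α ↦` level and pole bits) attached in parallel to a
two-special environment `𝓔`: pattern data = `acomb` of the box datum with the pattern datum. (memo FROM-fk-2-g28-ROOT-FORM §3) -/
def attP {BA C : Type*} (A : BA → SDat) (E : Env C) : Env (BA × C) := fun p =>
  ⟨acomb (A p.1) (E p.2).d0, acomb (A p.1) (E p.2).dy, acomb (A p.1) (E p.2).dz, acomb (A p.1) (E p.2).dyz⟩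

/-- kind indicator `[c_A = u ∧ c̄_A = v]` of a box datum, as a real number. (memo FROM-fk-2-g28-ROOT-FORM §3) -/
def kd (a : SDat) (u v : Bool) : ℝ := if a.c = u ∧ a.cb = v then 1 else 0

/-- the level-`K`, kind-`(1,0)`/`(0,1)` aggregate of a weight on `BA × C`: at `(true, γ)` the sum of `H(α,γ)` over `α` of kind `(1,0)` and
level `K`, at `(false, γ)` over kind `(0,1)`. (memo FROM-fk-2-g28-ROOT-FORM §3) -/
def aggW {BA C : Type*} [Fintype BA] (A : BA → SDat) (K : ℤ) (H : BA × C → ℝ) : Bool × C → ℝ := fun q =>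
  ∑ α, (if (A α).L = K then (1 : ℝ) else 0) * (if q.1 then kd (A α) true false else kd (A α) false true) * H (α, q.2)

section Pointwise

variable (a : SDat) (e : EDat) (J : ℤ)

/-- kind `(0,0)`: the box is invisible up to its level. [folklore] -/
theorem comb_of_kind00 (d : PDat) (hc : a.c = false) (hcb : a.cb = false) : acomb a d = ⟨d.lam + a.L, d.k1, d.k2⟩ := by
  obtain ⟨L, c, cb⟩ := a; cases hc; cases hcb; simp [acomb]; ring
/-- kind `(1,0)`: a parallel edge in replica 1. [folklore] -/
theorem comb_of_kind10 (d : PDat) (hc : a.c = true) (hcb : a.cb = false) :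
    acomb a d = ⟨(d.par true).lam + a.L, (d.par true).k1, (d.par true).k2⟩ := by
  obtain ⟨L, c, cb⟩ := a; cases hc; cases hcb; simp [acomb, PDat.par]; ring
/-- kind `(0,1)`: a parallel edge in replica 2. [folklore] -/
theorem comb_of_kind01 (d : PDat) (hc : a.c = false) (hcb : a.cb = true) :
    acomb a d = ⟨(d.par false).lam + a.L, (d.par false).k1, (d.par false).k2⟩ := by
  obtain ⟨L, c, cb⟩ := a; cases hc; cases hcb; simp [acomb, PDat.par]; ring
/-- kind `(1,1)`: two parallel edges in opposite replicas (poles identified). [folklore] -/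
theorem comb_of_kind11 (d : PDat) (hc : a.c = true) (hcb : a.cb = true) :
    acomb a d = ⟨((d.par true).par false).lam + a.L, ((d.par true).par false).k1, ((d.par true).par false).k2⟩ := by
  obtain ⟨L, c, cb⟩ := a; cases hc; cases hcb; obtain ⟨l, k1, k2⟩ := d; cases k1 <;> cases k2 <;> simp [acomb, PDat.par] <;> ring

/-- **The slot integrands of `A ∥ 𝓔` by kind.** [folklore] -/
theorem slots_attP_kind {BA C : Type*} (A : BA → SDat) (E : Env C) (α : BA) (γ : C) :
    ((A α).c = false → (A α).cb = false →
      (attP A E (α, γ)).slot1 J = (E γ).slot1 (J - (A α).L) ∧ (attP A E (α, γ)).slot0 J = (E γ).slot0 (J - (A α).L)) ∧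
    ((A α).c = true → (A α).cb = false →
      (attP A E (α, γ)).slot1 J = (parE E (true, γ)).slot1 (J - (A α).L) ∧ (attP A E (α, γ)).slot0 J = (parE E (true, γ)).slot0 (J - (A α).L)) ∧
    ((A α).c = false → (A α).cb = true →
      (attP A E (α, γ)).slot1 J = (parE E (false, γ)).slot1 (J - (A α).L) ∧ (attP A E (α, γ)).slot0 J = (parE E (false, γ)).slot0 (J - (A α).L)) ∧
    ((A α).c = true → (A α).cb = true →
      (attP A E (α, γ)).slot1 J = (E γ).andCon (J - (A α).L - 1) + (E γ).rconE (J - (A α).L) ∧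
        (attP A E (α, γ)).slot0 J = (E γ).andCon (J - (A α).L - 1) - (E γ).rconE (J - (A α).L)) := by
  refine ⟨fun hc hcb => ?_, fun hc hcb => ?_, fun hc hcb => ?_, fun hc hcb => ?_⟩
  · have h := integrands_of_addLam (E γ) (attP A E (α, γ)) (A α).L (comb_of_kind00 _ _ hc hcb) (comb_of_kind00 _ _ hc hcb)
      (comb_of_kind00 _ _ hc hcb) (comb_of_kind00 _ _ hc hcb) J
    exact ⟨h.1, h.2.1⟩
  · have h := integrands_of_addLam (parE E (true, γ)) (attP A E (α, γ)) (A α).L (comb_of_kind10 _ _ hc hcb) (comb_of_kind10 _ _ hc hcb)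
      (comb_of_kind10 _ _ hc hcb) (comb_of_kind10 _ _ hc hcb) J
    exact ⟨h.1, h.2.1⟩
  · have h := integrands_of_addLam (parE E (false, γ)) (attP A E (α, γ)) (A α).L (comb_of_kind01 _ _ hc hcb) (comb_of_kind01 _ _ hc hcb)
      (comb_of_kind01 _ _ hc hcb) (comb_of_kind01 _ _ hc hcb) J
    exact ⟨h.1, h.2.1⟩
  · have h := integrands_of_addLam (((E γ).par true).par false) (attP A E (α, γ)) (A α).L (comb_of_kind11 _ _ hc hcb)
      (comb_of_kind11 _ _ hc hcb) (comb_of_kind11 _ _ hc hcb) (comb_of_kind11 _ _ hc hcb) J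
    rw [h.1, h.2.1, show (false : Bool) = !true from rfl, EDat.slot1_par_par_mixed, EDat.slot0_par_par_mixed]
    exact ⟨by ring_nf, by ring_nf⟩

end Pointwise

section Main

variable {BA C : Type*} [Fintype BA] [Preorder BA] [Fintype C] [Preorder C] (A : BA → SDat) (E : Env C)

omit [Preorder BA] [Fintype C] [Preorder C] in
/-- `kd ≥ 0`. [folklore] -/
theorem kd_nonneg (a : SDat) (u v : Bool) : 0 ≤ kd a u v := by unfold kd; split_ifs <;> norm_num

omit [Preorder BA] [Fintype C] [Preorder C] in
/-- the four kinds sum to one. [folklore] -/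
theorem kd_sum (a : SDat) : kd a false false + kd a true true + kd a true false + kd a false true = 1 := by
  obtain ⟨L, c, cb⟩ := a; cases c <;> cases cb <;> simp [kd]

omit [Fintype BA] [Preorder BA] [Fintype C] [Preorder C] in
set_option linter.unusedSimpArgs false in
/-- **Pointwise decomposition of the integrand of `A ∥ 𝓔` by the kind of the box configuration.** [folklore] -/
theorem attP_integrand_kind (H0 H1 : BA × C → ℝ) (J : ℤ) (α : BA) (γ : C) :
    H1 (α, γ) * (attP A E (α, γ)).slot1 J + H0 (α, γ) * (attP A E (α, γ)).slot0 J =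
      kd (A α) false false * (H1 (α, γ) * (E γ).slot1 (J - (A α).L) + H0 (α, γ) * (E γ).slot0 (J - (A α).L))
      + kd (A α) true true * ((H1 (α, γ) + H0 (α, γ)) * (E γ).andCon (J - (A α).L - 1) + (H1 (α, γ) - H0 (α, γ)) * (E γ).rconE (J - (A α).L))
      + kd (A α) true false * (H1 (α, γ) * (parE E (true, γ)).slot1 (J - (A α).L) + H0 (α, γ) * (parE E (true, γ)).slot0 (J - (A α).L))
      + kd (A α) false true * (H1 (α, γ) * (parE E (false, γ)).slot1 (J - (A α).L) + H0 (α, γ) * (parE E (false, γ)).slot0 (J - (A α).L)) := by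
  obtain ⟨h00, h10, h01, h11⟩ := slots_attP_kind J A E α γ
  cases hc : (A α).c <;> cases hcb : (A α).cb
  · obtain ⟨e1, e0⟩ := h00 hc hcb
    simp only [kd, hc, hcb, e1, e0, Bool.true_eq_false, Bool.false_eq_true, and_self, and_true, and_false, true_and, false_and,
      if_true, if_false]; ring
  · obtain ⟨e1, e0⟩ := h01 hc hcb
    simp only [kd, hc, hcb, e1, e0, Bool.true_eq_false, Bool.false_eq_true, and_self, and_true, and_false, true_and, false_and,
      if_true, if_false]; ring
  · obtain ⟨e1, e0⟩ := h10 hc hcb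
    simp only [kd, hc, hcb, e1, e0, Bool.true_eq_false, Bool.false_eq_true, and_self, and_true, and_false, true_and, false_and,
      if_true, if_false]; ring
  · obtain ⟨e1, e0⟩ := h11 hc hcb
    simp only [kd, hc, hcb, e1, e0, Bool.true_eq_false, Bool.false_eq_true, and_self, and_true, and_false, true_and, false_and,
      if_true, if_false]; ring

omit [Fintype C] in
/-- The aggregate weight is monotone on `Bool × C` — the Bool-step is Theorem U for `A` at the exact level. [folklore] -/
theorem aggW_mono (hU : ∀ h : BA → ℝ, Monotone h → (∀ α, 0 ≤ h α) → ∀ K : ℤ,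
      0 ≤ ∑ α, h α * ((if (A α).L = K then (1 : ℝ) else 0) * (kd (A α) true false - kd (A α) false true)))
    {H : BA × C → ℝ} (mH : Monotone H) (nH : ∀ p, 0 ≤ H p) (K : ℤ) : Monotone (aggW A K H) := by
  have hlev : ∀ α, 0 ≤ (if (A α).L = K then (1 : ℝ) else 0) := fun α => by split_ifs <;> norm_num
  have step : ∀ γ, aggW A K H (false, γ) ≤ aggW A K H (true, γ) := by
    intro γ
    have key := hU (fun α => H (α, γ)) (mono_left mH γ) (fun α => nH _) K
    rw [← sub_nonneg]
    refine key.trans_eq ?_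
    simp only [aggW, if_true, Bool.false_eq_true, if_false, ← Finset.sum_sub_distrib]
    exact Finset.sum_congr rfl fun α _ => by ring
  have inC : ∀ b, Monotone fun γ => aggW A K H (b, γ) := fun b γ γ' hγ => by
    simp only [aggW]
    exact Finset.sum_le_sum fun α _ => mul_le_mul_of_nonneg_left (mono_right mH α hγ)
      (mul_nonneg (hlev α) (by cases b <;> exact kd_nonneg _ _ _))
  rintro ⟨b, γ⟩ ⟨b', γ'⟩ hle
  obtain ⟨hb, hγ⟩ := Prod.mk_le_mk.1 hle
  cases b <;> cases b'
  · exact inC false hγ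
  · exact (step γ).trans (inC true hγ)
  · exact absurd hb (by decide)
  · exact inC true hγ

omit [Preorder BA] [Fintype C] [Preorder C] in
/-- `aggW` is nonnegative for nonnegative weights. [folklore] -/
theorem aggW_nonneg {H : BA × C → ℝ} (nH : ∀ p, 0 ≤ H p) (K : ℤ) (q : Bool × C) : 0 ≤ aggW A K H q :=
  Finset.sum_nonneg fun α _ => mul_nonneg (mul_nonneg (by split_ifs <;> norm_num) (by cases q.1 <;> exact kd_nonneg _ _ _)) (nH _)

omit [Preorder BA] [Fintype C] [Preorder C] in
/-- `aggW` is monotone in the weight. [folklore] -/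
theorem aggW_le {H0 H1 : BA × C → ℝ} (le : ∀ p, H0 p ≤ H1 p) (K : ℤ) (q : Bool × C) : aggW A K H0 q ≤ aggW A K H1 q :=
  Finset.sum_le_sum fun α _ => mul_le_mul_of_nonneg_left (le _)
    (mul_nonneg (by split_ifs <;> norm_num) (by cases q.1 <;> exact kd_nonneg _ _ _))

omit [Preorder BA] [Preorder C] in
/-- The mixed-kind part of the root functional of `A ∥ 𝓔`, regrouped by the level of the box configuration, is a sum of parallel transforms
of `𝓔` against the aggregate weights. [folklore] -/
theorem attP_mixed_eq (H0 H1 : BA × C → ℝ) (J : ℤ) :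
    ∑ α, ∑ γ, kd (A α) true false * (H1 (α, γ) * (parE E (true, γ)).slot1 (J - (A α).L) + H0 (α, γ) * (parE E (true, γ)).slot0 (J - (A α).L))
      + ∑ α, ∑ γ, kd (A α) false true *
          (H1 (α, γ) * (parE E (false, γ)).slot1 (J - (A α).L) + H0 (α, γ) * (parE E (false, γ)).slot0 (J - (A α).L)) =
    ∑ K ∈ Finset.univ.image (fun α => (A α).L), Mt (parE E) (aggW A K H0) (aggW A K H1) (J - K) := by
  rw [← Finset.sum_add_distrib]
  simp only [← Finset.sum_add_distrib]
  -- insert the level indicator (the γ-sum of a fixed `α` only involves the level of `α`)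
  have ins : ∀ α, (∑ γ, (kd (A α) true false * (H1 (α, γ) * (parE E (true, γ)).slot1 (J - (A α).L) + H0 (α, γ) * (parE E (true, γ)).slot0 (J - (A α).L))
      + kd (A α) false true * (H1 (α, γ) * (parE E (false, γ)).slot1 (J - (A α).L) + H0 (α, γ) * (parE E (false, γ)).slot0 (J - (A α).L)))) =
      ∑ K ∈ Finset.univ.image (fun α => (A α).L), if (A α).L = K then
        ∑ γ, (kd (A α) true false * (H1 (α, γ) * (parE E (true, γ)).slot1 (J - K) + H0 (α, γ) * (parE E (true, γ)).slot0 (J - K))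
          + kd (A α) false true * (H1 (α, γ) * (parE E (false, γ)).slot1 (J - K) + H0 (α, γ) * (parE E (false, γ)).slot0 (J - K))) else 0 := by
    intro α
    rw [Finset.sum_ite_eq, if_pos (Finset.mem_image_of_mem _ (Finset.mem_univ α))]
  simp_rw [ins]
  rw [Finset.sum_comm]
  refine Finset.sum_congr rfl fun K _ => ?_
  unfold Mt
  rw [sum_bool_prod]
  simp only [aggW, if_true, Bool.false_eq_true, if_false, Finset.sum_mul, ← Finset.sum_add_distrib]
  rw [Finset.sum_comm]
  refine Finset.sum_congr rfl fun α _ => ?_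
  rw [← boole_mul, Finset.mul_sum]
  refine Finset.sum_congr rfl fun γ _ => by ring

/-- **Fact 1 for `A ∥ 𝓔`.**  From facts 1, 2, 4 of `𝓔` and Theorem U at exact level for the special-free box `A`, the nested root functional of
`A ∥ 𝓔` is nonnegative against every monotone nested nonnegative weight pair. [folklore] -/
theorem attP_Mt_nonneg
    (hU : ∀ h : BA → ℝ, Monotone h → (∀ α, 0 ≤ h α) → ∀ K : ℤ,
      0 ≤ ∑ α, h α * ((if (A α).L = K then (1 : ℝ) else 0) * (kd (A α) true false - kd (A α) false true)))
    (f1 : ∀ h0 h1 : C → ℝ, Monotone h0 → Monotone h1 → (∀ γ, 0 ≤ h0 γ) → (∀ γ, h0 γ ≤ h1 γ) → ∀ J : ℤ, 0 ≤ Mt E h0 h1 J)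
    (f2 : ∀ h0 h1 : Bool × C → ℝ, Monotone h0 → Monotone h1 → (∀ p, 0 ≤ h0 p) → (∀ p, h0 p ≤ h1 p) → ∀ J : ℤ, 0 ≤ Mt (parE E) h0 h1 J)
    (f4 : ∀ h : C → ℝ, Monotone h → (∀ γ, 0 ≤ h γ) → ∀ J : ℤ, 0 ≤ ∑ γ, h γ * (E γ).andCon J)
    {H0 H1 : BA × C → ℝ} (m0 : Monotone H0) (m1 : Monotone H1) (n0 : ∀ p, 0 ≤ H0 p) (le : ∀ p, H0 p ≤ H1 p) (J : ℤ) :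
    0 ≤ Mt (attP A E) H0 H1 J := by
  have n1 : ∀ p, 0 ≤ H1 p := fun p => (n0 p).trans (le p)
  unfold Mt
  rw [Fintype.sum_prod_type]
  simp_rw [attP_integrand_kind A E H0 H1 J]
  simp only [Finset.sum_add_distrib]
  rw [add_assoc, attP_mixed_eq]
  refine add_nonneg (add_nonneg (Finset.sum_nonneg fun α _ => ?_) (Finset.sum_nonneg fun α _ => ?_)) (Finset.sum_nonneg fun K _ => ?_)
  · rw [← Finset.mul_sum]
    exact mul_nonneg (kd_nonneg _ _ _) (f1 _ _ (mono_right m0 α) (mono_right m1 α) (fun γ => n0 _) (fun γ => le _) _)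
  · rw [← Finset.mul_sum]
    refine mul_nonneg (kd_nonneg _ _ _) ?_
    rw [Finset.sum_add_distrib]
    refine add_nonneg (f4 _ ((mono_right m1 α).add (mono_right m0 α)) (fun γ => add_nonneg (n1 _) (n0 _)) _)
      (Finset.sum_nonneg fun γ _ => mul_nonneg (sub_nonneg.2 (le _)) (EDat.rconE_nonneg _ _))
  · exact f2 _ _ (aggW_mono A hU m0 n0 K) (aggW_mono A hU m1 n1 K) (aggW_nonneg A n0 K) (aggW_le A le K) _

end Main

section Regroup

variable {BA C : Type*} [Fintype BA] [Fintype C] (A : BA → SDat)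

/-- **Regrouping the mixed kinds by level.** [folklore] -/
theorem regroup (H0 H1 : BA × C → ℝ) (X1t X0t X1f X0f : C → ℤ → ℝ) (J : ℤ) :
    ∑ α, ∑ γ, kd (A α) true false * (H1 (α, γ) * X1t γ (J - (A α).L) + H0 (α, γ) * X0t γ (J - (A α).L))
      + ∑ α, ∑ γ, kd (A α) false true * (H1 (α, γ) * X1f γ (J - (A α).L) + H0 (α, γ) * X0f γ (J - (A α).L)) =
    ∑ K ∈ Finset.univ.image (fun α => (A α).L), ∑ γ, (aggW A K H1 (true, γ) * X1t γ (J - K) + aggW A K H0 (true, γ) * X0t γ (J - K)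
      + (aggW A K H1 (false, γ) * X1f γ (J - K) + aggW A K H0 (false, γ) * X0f γ (J - K))) := by
  rw [← Finset.sum_add_distrib]
  simp only [← Finset.sum_add_distrib]
  have ins : ∀ α, (∑ γ, (kd (A α) true false * (H1 (α, γ) * X1t γ (J - (A α).L) + H0 (α, γ) * X0t γ (J - (A α).L))
      + kd (A α) false true * (H1 (α, γ) * X1f γ (J - (A α).L) + H0 (α, γ) * X0f γ (J - (A α).L)))) =
      ∑ K ∈ Finset.univ.image (fun α => (A α).L), if (A α).L = K then
        ∑ γ, (kd (A α) true false * (H1 (α, γ) * X1t γ (J - K) + H0 (α, γ) * X0t γ (J - K))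
          + kd (A α) false true * (H1 (α, γ) * X1f γ (J - K) + H0 (α, γ) * X0f γ (J - K))) else 0 := by
    intro α
    rw [Finset.sum_ite_eq, if_pos (Finset.mem_image_of_mem _ (Finset.mem_univ α))]
  simp_rw [ins]
  rw [Finset.sum_comm]
  refine Finset.sum_congr rfl fun K _ => ?_
  simp only [aggW, if_true, Bool.false_eq_true, if_false, Finset.sum_mul, ← Finset.sum_add_distrib]
  rw [Finset.sum_comm]
  refine Finset.sum_congr rfl fun α _ => ?_
  rw [← boole_mul, Finset.mul_sum]
  refine Finset.sum_congr rfl fun γ _ => by ring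

end Regroup

section AcombPar

/-- A free parallel edge commutes with the parallel attachment of box data (per pattern). [folklore] -/
theorem acomb_par (a : SDat) (d : PDat) (b : Bool) : (acomb a d).par b = acomb a (d.par b) := by
  obtain ⟨L, c, cb⟩ := a; obtain ⟨l, k1, k2⟩ := d
  cases b <;> cases c <;> cases cb <;> cases k1 <;> cases k2 <;> simp [acomb, PDat.par] <;> ring

end AcombPar

end RootForm

end FK

end Summit.CriticalPhenomena.PercolationContinuityZ3.Theorems

end
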